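import Literature.NumberTheory.Sieve.LargestPrimeFactorCubicCCount
import Literature.NumberTheory.Sieve.LargestPrimeFactorCubicSetup
import HarnessLib

/-!
# Heath-Brown 2001 (PLMS), §§4, 6: the sieve-weighted `c`-count for a fixed pair `(a, b)` —
# `∑_{d∣Q} λ_d ∑_{p∈𝒦} #{c : (2.11), pd ∣ N(α)} = m f(q) ∑_d ∑_p λ_d 𝟙 ρ(pd)/(pd) + O(3^{ω(q)} ∑∑ |λ_d| ρ(pd))`

Topic `Literature/NumberTheory/Sieve`; a PROVED counting layer (definitions with bodies, no named facts)
under the named fact `Irving2015_largestPrimeFactor_cubic` (`LargestPrimeFactorCubic.lean`), joining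
`…CCount` (the `c`-count with the norm condition `e ∣ N(α)` for ODD `e` coprime to `q`) with the sieve
bookkeeping of the parallel seat's `…Setup` (`λ_d`, `Q = ∏_{p<X^δ} p`, `𝒦`).  Source: D. R. Heath-Brown,
*The largest prime factor of `X³ + 2`*, Proc. London Math. Soc. (3) 82 (2001) 554–596: §4 (4.2)–(4.4)
(pp. 16–17: the sums over `c` in classes modulo `rsN(KA)`, "providing that `KA` is coprime to `q`")
and §6 pp. 21–22 (the conditions `(K, q) = 1`, and "`d` is square-free with `d ∣ Q` and `(d, 2q) = 1`";
"`g_q(p) = 0` for `p ∣ 2q`").  For the remaining pairs `(d, p)` the count VANISHES: `N(α)` is odd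
(`a` is odd as `(q, 6) = 1`), and `(N(α), q) = 1` by (3.1) (`isCoprime_norm_q`).

PROVED here, for `(a, b)` with `q = a³ − 2b³` square-free and coprime to `6` (`HBPair a b q`), any
`(C, C+m]`, and `X` with all `p ∈ 𝒦` odd:

* `cCount a b q C m e = #{C < c ≤ C+m : (2.11), e ∣ N(a + b∛2 + c∛4)}`; `cCount_eq_zero_of_even`,
  `cCount_eq_zero_of_dvd_q` (the vanishing cases);
* `Aind q d p = 𝟙[d odd, (d, q) = 1, p ∤ q]`, `Wab X a b q C m = ∑_{d∣Q} λ_d ∑_{p∈𝒦} cCount(pd)`;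
* **`abs_Wab_sub_le`** —
  `|Wab − m f(q) ∑_{d∣Q} λ_d ∑_{p∈𝒦} 𝟙 ρ(pd)/(pd)| ≤ 3^{ω(q)} ∑_{d∣Q} |λ_d| ∑_{p∈𝒦} 𝟙 ρ(pd)`,
  `ρ(e) = #{j < e : e ∣ j³ − 2}`.

## References

* D. R. Heath-Brown, *The largest prime factor of `X³ + 2`*, Proc. London Math. Soc. (3) 82 (2001)
  554–596, §4 (4.2)–(4.4) pp. 16–17, §6 pp. 21–22, §3 (3.1). [`HeathBrown2001LargestPrimeFactorCubic`]

## Mathlib / tree search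

Tree: `HBPair`, `fq`, `abs_card_ccond_dvd_absNorm_sub_le` (`…CCount`/`…CCondCount`);
`LargestPrimeFactorCubic.lam`, `sievePrimes`, `kPrimes`, `mem_kPrimes`, `normNat`, `normf`,
`absNorm_genIdeal`, `genIdeal`, `gen` (`…Setup`), `isCoprime_norm_q` (`…Generators`).
Mathlib: `Nat.Coprime.mul`, `Nat.Prime.coprime_iff_not_dvd`, `Int.isCoprime_iff_gcd_eq_one`,
`Nat.Prime.eq_one_of_self_dvd`, `Int.odd_iff_not_even`.
-/

noncomputable section

open Finset NumberField

namespace Literature.NumberTheory.Sieve.HeathBrown2001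

open LFunctions.CubeRootTwoField CubicSieve LargestPrimeFactorCubic

variable {a b q : ℕ}

/-! ### The `c`-count and its vanishing cases -/

/-- `cCount a b q C m e = #{C < c ≤ C+m : (b² − ac, q) = (a² + bc, q) = 1, e ∣ N(a + b∛2 + c∛4)}`.
[cite: HeathBrown2001LargestPrimeFactorCubic, §4 (4.2)–(4.3)] -/
def cCount (a b q C m e : ℕ) : ℕ :=
  #((Ioc C (C + m)).filter fun c : ℕ =>
    (Int.gcd ((b : ℤ) ^ 2 - a * c) q = 1 ∧ Int.gcd ((a : ℤ) ^ 2 + b * c) q = 1) ∧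
      e ∣ Ideal.absNorm (Ideal.span {coordElt ((a : ℤ), (b : ℤ), (c : ℤ))}))

/-- `N(a + b∛2 + c∛4) = |a³ + 2b³ + 4c³ − 6abc|` as a natural number. [folklore] -/
theorem absNorm_span_coordElt_eq (a b c : ℕ) :
    Ideal.absNorm (Ideal.span {coordElt ((a : ℤ), (b : ℤ), (c : ℤ))}) = normNat (a, b, c) :=
  absNorm_genIdeal (a, b, c)

/-- `a` is odd when `q = a³ − 2b³` is coprime to `6`. [folklore] -/
theorem HBPair.odd_a (h : HBPair a b q) : Odd a := by
  have hq : Odd q := by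
    have h6 := h.cop6
    rw [Nat.odd_iff]
    by_contra h2
    have : 2 ∣ Nat.gcd q 6 := Nat.dvd_gcd (Nat.dvd_of_mod_eq_zero (by omega)) (by norm_num)
    rw [h6] at this; omega
  by_contra ha
  rw [Nat.not_odd_iff_even] at ha
  obtain ⟨k, hk⟩ := ha
  have h2 : (2 : ℤ) ∣ (q : ℤ) := by
    rw [h.q_eq, hk]; push_cast
    exact ⟨4 * (k : ℤ) ^ 3 - (b : ℤ) ^ 3, by ring⟩
  have h2' : 2 ∣ q := by exact_mod_cast h2
  rw [Nat.odd_iff] at hq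
  omega

/-- `N(α)` is odd (so an even `e` never divides it). [cite: HeathBrown2001LargestPrimeFactorCubic, §6 p. 22 ("(d, 2q) = 1")] -/
theorem HBPair.odd_normNat (h : HBPair a b q) (c : ℕ) : Odd (normNat (a, b, c)) := by
  obtain ⟨k, hk⟩ := h.odd_a
  rw [normNat, Int.natAbs_odd, normf]
  simp only
  refine ⟨4 * (k : ℤ) ^ 3 + 6 * k ^ 2 + 3 * k + (b : ℤ) ^ 3 + 2 * (c : ℤ) ^ 3 - 3 * a * b * c, ?_⟩
  have : (a : ℤ) = 2 * k + 1 := by exact_mod_cast hk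
  rw [this]; ring

/-- **Even moduli contribute nothing**: `cCount … e = 0` for even `e`. [cite: HeathBrown2001LargestPrimeFactorCubic, §6 p. 22] -/
theorem cCount_eq_zero_of_even (h : HBPair a b q) (C m : ℕ) {e : ℕ} (he : Even e) : cCount a b q C m e = 0 := by
  rw [cCount, card_eq_zero, filter_eq_empty_iff]
  rintro c - ⟨-, hdvd⟩
  rw [absNorm_span_coordElt_eq] at hdvd
  have h2 : 2 ∣ normNat (a, b, c) := (even_iff_two_dvd.mp he).trans hdvd
  exact (Nat.not_even_iff_odd.mpr (h.odd_normNat c)) (even_iff_two_dvd.mpr h2)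

/-- **Moduli sharing a prime with `q` contribute nothing**: if a prime `ℓ ∣ e` divides `q`, then
`cCount … e = 0` ((3.1): `(N(α), q) = 1` under (2.11)). [cite: HeathBrown2001LargestPrimeFactorCubic, §3 (3.1) and §6 p. 21 ("(K, q) = 1")] -/
theorem cCount_eq_zero_of_dvd_q (h : HBPair a b q) (C m : ℕ) {e ℓ : ℕ} (hℓ : ℓ.Prime) (hℓe : ℓ ∣ e)
    (hℓq : ℓ ∣ q) : cCount a b q C m e = 0 := by
  rw [cCount, card_eq_zero, filter_eq_empty_iff]
  rintro c - ⟨⟨hC, hD⟩, hdvd⟩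
  rw [absNorm_span_coordElt_eq] at hdvd
  have hN : (ℓ : ℤ) ∣ normf (a, b, c) := by
    have : ℓ ∣ normNat (a, b, c) := hℓe.trans hdvd
    rw [normNat] at this
    exact Int.dvd_natAbs.mp (Int.natCast_dvd_natCast.mpr this)
  have h2 : IsCoprime (2 : ℤ) ((a : ℤ) ^ 3 - 2 * (b : ℤ) ^ 3) := by
    rw [← h.q_eq, Int.isCoprime_iff_gcd_eq_one]
    have h6 := h.cop6
    have : Nat.Coprime 2 q := by
      rw [Nat.Coprime, Nat.gcd_comm]
      exact Nat.Coprime.coprime_dvd_right (by norm_num : 2 ∣ 6) h6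
    exact_mod_cast this
  have hCq : IsCoprime ((b : ℤ) ^ 2 - a * c) ((a : ℤ) ^ 3 - 2 * (b : ℤ) ^ 3) := by
    rw [← h.q_eq, Int.isCoprime_iff_gcd_eq_one]; exact hC
  have hDq : IsCoprime ((a : ℤ) ^ 2 + b * c) ((a : ℤ) ^ 3 - 2 * (b : ℤ) ^ 3) := by
    rw [← h.q_eq, Int.isCoprime_iff_gcd_eq_one]; exact hD
  have hcop := isCoprime_norm_q h2 hCq hDq
  rw [← h.q_eq] at hcop
  have hNf : normf (a, b, c) = (a : ℤ) ^ 3 + 2 * (b : ℤ) ^ 3 + 4 * (c : ℤ) ^ 3 - 6 * a * b * c := by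
    rw [normf]
  rw [← hNf] at hcop
  have hunit := hcop.isUnit_of_dvd' hN (by exact_mod_cast hℓq)
  rw [Int.isUnit_iff_natAbs_eq, Int.natAbs_natCast] at hunit
  exact hℓ.one_lt.ne' hunit

/-! ### The sieve-weighted count -/

/-- The indicator of the contributing pairs `(d, p)`: `d` odd, `(d, q) = 1`, `p ∤ q`. [cite: HeathBrown2001LargestPrimeFactorCubic, §6 pp. 21–22] -/
def Aind (q d p : ℕ) : ℝ := if Odd d ∧ d.Coprime q ∧ ¬ p ∣ q then 1 else 0

/-- `ρ(e) = #{j < e : e ∣ j³ − 2}` (the `rootsCube` of `…RootPairs`, kept unfolded here). [folklore] -/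
def rho3 (e : ℕ) : ℕ := #((range e).filter fun j : ℕ => (e : ℤ) ∣ (j : ℤ) ^ 3 - 2)

/-- **`W(a,b) = ∑_{d∣Q} λ_d ∑_{p∈𝒦} cCount(pd)`**: the sieve-weighted `c`-count of the pair `(a, b)`
(the inner sums of `S₀` after `…S0Expand`, for the generators of one cube edge).
[cite: HeathBrown2001LargestPrimeFactorCubic, §4 p. 16] -/
def Wab (X a b q C m : ℕ) : ℝ :=
  ∑ d ∈ (sievePrimes X).divisors, lam X d * ∑ p ∈ kPrimes X, (cCount a b q C m (p * d) : ℝ)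

/-- **Per-pair main term with error**: with all `p ∈ 𝒦` odd,
`|W(a,b) − m f(q) ∑_{d∣Q} λ_d ∑_{p∈𝒦} 𝟙(d,p) ρ(pd)/(pd)| ≤ 3^{ω(q)} ∑_{d∣Q} |λ_d| ∑_{p∈𝒦} 𝟙(d,p) ρ(pd)`.
[cite: HeathBrown2001LargestPrimeFactorCubic, §4 (4.2)–(4.4), §6 pp. 21–22] -/
theorem abs_Wab_sub_le {X : ℕ} (h : HBPair a b q) (hk : ∀ p ∈ kPrimes X, Odd p) (C m : ℕ) :
    |Wab X a b q C m - m * fq q * ∑ d ∈ (sievePrimes X).divisors, lam X d *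
        ∑ p ∈ kPrimes X, Aind q d p * rho3 (p * d) / ((p : ℝ) * d)| ≤
      (3 : ℝ) ^ q.primeFactors.card * ∑ d ∈ (sievePrimes X).divisors, |lam X d| *
        ∑ p ∈ kPrimes X, Aind q d p * rho3 (p * d) := by
  -- the difference, term by term
  have hterm : ∀ d ∈ (sievePrimes X).divisors, ∀ p ∈ kPrimes X,
      |(cCount a b q C m (p * d) : ℝ) - m * fq q * (Aind q d p * rho3 (p * d) / ((p : ℝ) * d))| ≤
        (3 : ℝ) ^ q.primeFactors.card * (Aind q d p * rho3 (p * d)) := by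
    intro d hd p hp
    have hd0 : 0 < d := Nat.pos_of_mem_divisors hd
    obtain ⟨hpP, -, -⟩ := mem_kPrimes hp
    by_cases hA : Odd d ∧ d.Coprime q ∧ ¬ p ∣ q
    · -- the contributing case: `e = pd` odd and coprime to `q`
      rw [Aind, if_pos hA]
      obtain ⟨hdodd, hdq, hpq⟩ := hA
      have hpodd := hk p hp
      have he : 0 < p * d := Nat.mul_pos hpP.pos hd0
      have heodd : Odd (p * d) := hpodd.mul hdodd
      have hecop : (p * d).Coprime q := Nat.Coprime.mul_left ((hpP.coprime_iff_not_dvd).mpr hpq) hdq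
      have hmain := abs_card_ccond_dvd_absNorm_sub_le h he heodd hecop C m
      try simp only [one_mul]
      have e1 : (cCount a b q C m (p * d) : ℝ) = #((Ioc C (C + m)).filter fun c : ℕ =>
          (Int.gcd ((b : ℤ) ^ 2 - a * c) q = 1 ∧ Int.gcd ((a : ℤ) ^ 2 + b * c) q = 1) ∧
            p * d ∣ Ideal.absNorm (Ideal.span {coordElt ((a : ℤ), (b : ℤ), (c : ℤ))})) := rfl
      have e2 : (rho3 (p * d) : ℝ) = #((range (p * d)).filter fun j : ℕ => ((p * d : ℕ) : ℤ) ∣ (j : ℤ) ^ 3 - 2) := rfl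
      rw [e1, e2]
      have e3 : (m : ℝ) * fq q * (#((range (p * d)).filter fun j : ℕ => ((p * d : ℕ) : ℤ) ∣ (j : ℤ) ^ 3 - 2) / ((p : ℝ) * d)) =
          #((range (p * d)).filter fun j : ℕ => ((p * d : ℕ) : ℤ) ∣ (j : ℤ) ^ 3 - 2) * (m * fq q / ((p * d : ℕ) : ℝ)) := by
        push_cast; ring
      rw [e3, mul_comm ((3 : ℝ) ^ q.primeFactors.card)]
      exact hmain
    · -- the vanishing cases
      rw [Aind, if_neg hA]
      have h0 : cCount a b q C m (p * d) = 0 := by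
        by_cases hdodd : Odd d
        · by_cases hdq : d.Coprime q
          · have hpq : p ∣ q := by by_contra hpq; exact hA ⟨hdodd, hdq, hpq⟩
            exact cCount_eq_zero_of_dvd_q h C m hpP (dvd_mul_right p d) hpq
          · obtain ⟨ℓ, hℓ, hℓd, hℓq⟩ := Nat.Prime.not_coprime_iff_dvd.mp hdq
            exact cCount_eq_zero_of_dvd_q h C m hℓ (hℓd.trans (dvd_mul_left d p)) hℓq
        · rw [Nat.not_odd_iff_even] at hdodd
          exact cCount_eq_zero_of_even h C m (hdodd.mul_left p)
      rw [h0]; simp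
  -- sum up
  rw [Wab, mul_sum, ← sum_sub_distrib]
  calc |∑ d ∈ (sievePrimes X).divisors, (lam X d * ∑ p ∈ kPrimes X, (cCount a b q C m (p * d) : ℝ) -
        m * fq q * (lam X d * ∑ p ∈ kPrimes X, Aind q d p * rho3 (p * d) / ((p : ℝ) * d)))|
      ≤ ∑ d ∈ (sievePrimes X).divisors, |lam X d * ∑ p ∈ kPrimes X, (cCount a b q C m (p * d) : ℝ) -
          m * fq q * (lam X d * ∑ p ∈ kPrimes X, Aind q d p * rho3 (p * d) / ((p : ℝ) * d))| :=
        abs_sum_le_sum_abs _ _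
    _ ≤ ∑ d ∈ (sievePrimes X).divisors, |lam X d| * ((3 : ℝ) ^ q.primeFactors.card *
          ∑ p ∈ kPrimes X, Aind q d p * rho3 (p * d)) := by
        refine sum_le_sum fun d hd => ?_
        have e : lam X d * ∑ p ∈ kPrimes X, (cCount a b q C m (p * d) : ℝ) -
            m * fq q * (lam X d * ∑ p ∈ kPrimes X, Aind q d p * rho3 (p * d) / ((p : ℝ) * d)) =
            lam X d * ∑ p ∈ kPrimes X, ((cCount a b q C m (p * d) : ℝ) -
              m * fq q * (Aind q d p * rho3 (p * d) / ((p : ℝ) * d))) := by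
          simp only [mul_sum]
          rw [← sum_sub_distrib]
          exact sum_congr rfl fun p _ => by ring
        rw [e, abs_mul]
        refine mul_le_mul_of_nonneg_left ?_ (abs_nonneg _)
        calc |∑ p ∈ kPrimes X, ((cCount a b q C m (p * d) : ℝ) - m * fq q * (Aind q d p * rho3 (p * d) / ((p : ℝ) * d)))|
            ≤ ∑ p ∈ kPrimes X, |(cCount a b q C m (p * d) : ℝ) - m * fq q * (Aind q d p * rho3 (p * d) / ((p : ℝ) * d))| :=
              abs_sum_le_sum_abs _ _
          _ ≤ ∑ p ∈ kPrimes X, (3 : ℝ) ^ q.primeFactors.card * (Aind q d p * rho3 (p * d)) :=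
              sum_le_sum fun p hp => hterm d hd p hp
          _ = (3 : ℝ) ^ q.primeFactors.card * ∑ p ∈ kPrimes X, Aind q d p * rho3 (p * d) := by rw [mul_sum]
    _ = (3 : ℝ) ^ q.primeFactors.card * ∑ d ∈ (sievePrimes X).divisors, |lam X d| *
          ∑ p ∈ kPrimes X, Aind q d p * rho3 (p * d) := by
        rw [mul_sum]; exact sum_congr rfl fun d _ => by ring

end Literature.NumberTheory.Sieve.HeathBrown2001
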